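import Mathlib
import Summits.Ventures.HodgeRepro2.A1TensorSplitting
import Summits.Ventures.HodgeRepro2.A1EigenlineDecomposition
import Summits.Ventures.HodgeRepro2.T5ConjugateEigenlines

/-!
# T5EigenlineBridge — the eigenLINES of the `F`-action on `F ⊗_ℚ ℂ`, and the bridge to p7's `eigenline`

Built on p7's `A1TensorSplitting.tensorEquiv F : ℂ ⊗[ℚ] F ≃ₐ[ℂ] ((F →ₐ[ℚ] ℂ) → ℂ)` (the comparison
`F ⊗_ℚ ℂ ≅ ∏_σ ℂ`, imported, not re-proved) and p1's `T5ConjugateEigenlines.jointEigenspace`: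

* `tensorEquiv` intertwines the base-changed multiplication by `a ∈ F` with the diagonal action
  `(σ ↦ σ a · −)` (`tensorEquiv_baseChange_mulF`), so the joint `σ`-eigenspace `eigenspaceF F σ` of the
  `F`-action on `ℂ ⊗[ℚ] F` (rank-one case: `H¹(A, ℚ) ≅ F`) is carried onto the coordinate line of `σ`
  (`map_eigenspaceF`), is ONE-DIMENSIONAL (`finrank_eigenspaceF`) — the eigenLINE `e_σ` — and the eigenlines
  span (`iSup_eigenspaceF`);
* BRIDGE: for `M = ℂ ⊗[ℚ] F` (a module over itself) p7's `A1EigenlineDecomposition.eigenline F σ'` and p1's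
  `eigenspaceF F σ` are the same set of vectors (`eigenline_eq_eigenspaceF`; `σ' = σ.toRatAlgHom`) — the two
  annexes describe the same eigenlines, in the `F →ₐ[ℚ] ℂ` and the `F →+* ℂ` vocabulary respectively.

Not formalised: cohomology, the comparison isomorphism, Hodge types, modules of higher `F`-rank.
-/

namespace Summit.Ventures.HodgeRepro2.T5EigenlineBridge

open TensorProduct A1TensorSplitting

variable (F : Type*) [Field F] [NumberField F]

/-- Multiplication by `a ∈ F` on `F`, as a `ℚ`-linear map (the `F`-action on the rank-one module `F`). -/
def mulF (a : F) : F →ₗ[ℚ] F := LinearMap.mulLeft ℚ a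

/-- `mulF a x = a * x`. -/
@[simp] theorem mulF_apply (a x : F) : mulF F a x = a * x := rfl

/-- `tensorEquiv` intertwines the base-changed multiplication by `a` with the diagonal action. -/
theorem tensorEquiv_baseChange_mulF (a : F) (x : ℂ ⊗[ℚ] F) (σ : F →ₐ[ℚ] ℂ) :
    tensorEquiv F ((mulF F a).baseChange ℂ x) σ = σ a * tensorEquiv F x σ := by
  induction x using TensorProduct.induction_on with
  | zero => simp
  | tmul z y =>
    rw [LinearMap.baseChange_tmul, tensorEquiv_tmul, tensorEquiv_tmul, mulF_apply, map_mul]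
    ring
  | add x y hx hy =>
    simp only [map_add, Pi.add_apply, hx, hy, mul_add]

/-- The joint `σ`-eigenspace of the `F`-action on `ℂ ⊗[ℚ] F` (`T5ConjugateEigenlines.jointEigenspace`). -/
noncomputable abbrev eigenspaceF (σ : F →+* ℂ) : Submodule ℂ (ℂ ⊗[ℚ] F) :=
  T5ConjugateEigenlines.jointEigenspace (mulF F) (σ : F → ℂ)

/-- The coordinate line of `σ` in `ℂ^{Hom_ℚ(F,ℂ)}`: the functions vanishing at every `σ' ≠ σ`. -/
def coordLine (σ : F →ₐ[ℚ] ℂ) : Submodule ℂ ((F →ₐ[ℚ] ℂ) → ℂ) where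
  carrier := {y | ∀ σ', σ' ≠ σ → y σ' = 0}
  add_mem' := by
    intro y z hy hz σ' h
    simp [hy σ' h, hz σ' h]
  zero_mem' := by
    intro σ' _
    rfl
  smul_mem' := by
    intro c y hy σ' h
    simp [hy σ' h]

/-- Membership in the coordinate line: all other coordinates vanish. -/
theorem mem_coordLine_iff (σ : F →ₐ[ℚ] ℂ) (y : (F →ₐ[ℚ] ℂ) → ℂ) :
    y ∈ coordLine F σ ↔ ∀ σ', σ' ≠ σ → y σ' = 0 :=
  Iff.rfl

/-- The coordinate line is spanned by the indicator of `σ`. -/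
theorem coordLine_eq_span (σ : F →ₐ[ℚ] ℂ) [DecidableEq (F →ₐ[ℚ] ℂ)] :
    coordLine F σ = Submodule.span ℂ {Pi.single σ (1 : ℂ)} := by
  ext y
  rw [mem_coordLine_iff, Submodule.mem_span_singleton]
  constructor
  · intro h
    refine ⟨y σ, ?_⟩
    funext σ'
    by_cases hσ' : σ' = σ
    · subst hσ'
      simp
    · simp [hσ', h σ' hσ']
  · rintro ⟨c, rfl⟩ σ' hσ'
    simp [hσ']

/-- The coordinate line is a line. -/
theorem finrank_coordLine (σ : F →ₐ[ℚ] ℂ) : Module.finrank ℂ (coordLine F σ) = 1 := by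
  classical
  rw [coordLine_eq_span]
  apply finrank_span_singleton
  intro h
  have := congrFun h σ
  simp at this

/-- `x` lies in the `σ`-eigenspace iff `tensorEquiv x` lies on the coordinate line of `σ`. -/
theorem mem_eigenspaceF_iff (σ : F →+* ℂ) (x : ℂ ⊗[ℚ] F) :
    x ∈ eigenspaceF F σ ↔ tensorEquiv F x ∈ coordLine F σ.toRatAlgHom := by
  rw [T5ConjugateEigenlines.mem_jointEigenspace_iff, mem_coordLine_iff]
  constructor
  · intro h σ' hσ'
    obtain ⟨a, ha⟩ : ∃ a, σ' a ≠ σ a := by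
      by_contra hcon
      exact hσ' (AlgHom.ext fun a => by
        by_contra ha
        exact hcon ⟨a, ha⟩)
    have h1 := congrFun (congrArg (tensorEquiv F) (h a)) σ'
    rw [tensorEquiv_baseChange_mulF, map_smul, Pi.smul_apply, smul_eq_mul] at h1
    have h2 : (σ' a - σ a) * tensorEquiv F x σ' = 0 := by rw [sub_mul, h1, sub_self]
    exact (mul_eq_zero.1 h2).resolve_left (sub_ne_zero.2 ha)
  · intro h a
    apply (tensorEquiv F).injective
    funext σ'
    rw [tensorEquiv_baseChange_mulF, map_smul, Pi.smul_apply, smul_eq_mul]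
    by_cases hσ' : σ' = σ.toRatAlgHom
    · subst hσ'
      rfl
    · rw [h σ' hσ', mul_zero, mul_zero]

/-- `tensorEquiv` carries the `σ`-eigenspace onto the coordinate line of `σ`. -/
theorem map_eigenspaceF (σ : F →+* ℂ) :
    (eigenspaceF F σ).map ((tensorEquiv F).toLinearEquiv : ℂ ⊗[ℚ] F →ₗ[ℂ] ((F →ₐ[ℚ] ℂ) → ℂ)) =
      coordLine F σ.toRatAlgHom := by
  ext y
  rw [Submodule.mem_map]
  constructor
  · rintro ⟨x, hx, rfl⟩
    exact (mem_eigenspaceF_iff F σ x).1 hx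
  · intro hy
    obtain ⟨x, rfl⟩ := (tensorEquiv F).surjective y
    exact ⟨x, (mem_eigenspaceF_iff F σ x).2 hy, rfl⟩

/-- THE EIGENLINES: every joint `σ`-eigenspace of the `F`-action on `F ⊗_ℚ ℂ` is one-dimensional. -/
theorem finrank_eigenspaceF (σ : F →+* ℂ) : Module.finrank ℂ (eigenspaceF F σ) = 1 := by
  rw [← LinearEquiv.finrank_map_eq (tensorEquiv F).toLinearEquiv (eigenspaceF F σ), map_eigenspaceF,
    finrank_coordLine]

/-- The eigenlines span: `F ⊗_ℚ ℂ = ⊕_σ e_σ` (the spanning half; the independence half is p7's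
`A1EigenlineDecomposition.isInternal_eigenline` through the bridge below). -/
theorem iSup_eigenspaceF : ⨆ σ : F →+* ℂ, eigenspaceF F σ = ⊤ := by
  classical
  rw [eq_top_iff]
  intro x _
  set e := (tensorEquiv F).toLinearEquiv with he
  have hy : e x = ∑ σ : F →+* ℂ, e x σ.toRatAlgHom •
      (Pi.single σ.toRatAlgHom (1 : ℂ) : (F →ₐ[ℚ] ℂ) → ℂ) := by
    funext σ'
    rw [Finset.sum_apply]
    rw [Finset.sum_eq_single (RingHom.equivRatAlgHom.symm σ')]
    · simp
    · intro σ _ hσ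
      have : σ.toRatAlgHom ≠ σ' := by
        intro h
        apply hσ
        rw [← h, ← RingHom.equivRatAlgHom_apply, Equiv.symm_apply_apply]
      simp [this]
    · intro h
      exact absurd (Finset.mem_univ _) h
  have hx : x = e.symm (∑ σ : F →+* ℂ, e x σ.toRatAlgHom •
      (Pi.single σ.toRatAlgHom (1 : ℂ) : (F →ₐ[ℚ] ℂ) → ℂ)) := by
    rw [← hy, LinearEquiv.symm_apply_apply]
  have hmem : ∀ σ : F →+* ℂ,
      e.symm (e x σ.toRatAlgHom • Pi.single σ.toRatAlgHom (1 : ℂ)) ∈ eigenspaceF F σ := by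
    intro σ
    rw [mem_eigenspaceF_iff, mem_coordLine_iff]
    intro σ' hσ'
    have : tensorEquiv F (e.symm (e x σ.toRatAlgHom • Pi.single σ.toRatAlgHom (1 : ℂ))) =
        e x σ.toRatAlgHom • Pi.single σ.toRatAlgHom (1 : ℂ) :=
      e.apply_symm_apply _
    rw [this]
    simp [hσ']
  rw [hx, map_sum]
  exact Submodule.sum_mem _ fun σ _ => Submodule.mem_iSup_of_mem σ (hmem σ)

section Bridge

/-- `(1 ⊗ a) * x` is the base-changed multiplication by `a`. -/
theorem one_tmul_mul (a : F) (x : ℂ ⊗[ℚ] F) :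
    ((1 : ℂ) ⊗ₜ[ℚ] a) * x = (mulF F a).baseChange ℂ x := by
  induction x using TensorProduct.induction_on with
  | zero => simp
  | tmul z y =>
    rw [Algebra.TensorProduct.tmul_mul_tmul, LinearMap.baseChange_tmul, mulF_apply, one_mul]
  | add x y hx hy =>
    rw [mul_add, map_add, hx, hy]

/-- `(c ⊗ 1) * x` is the scalar action of `c`. -/
theorem tmul_one_mul (c : ℂ) (x : ℂ ⊗[ℚ] F) : (c ⊗ₜ[ℚ] (1 : F)) * x = c • x := by
  induction x using TensorProduct.induction_on with
  | zero => simp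
  | tmul z y =>
    rw [Algebra.TensorProduct.tmul_mul_tmul, one_mul, TensorProduct.smul_tmul', smul_eq_mul]
  | add x y hx hy =>
    rw [mul_add, smul_add, hx, hy]

open A1EigenlineDecomposition in
/-- BRIDGE: for `M = ℂ ⊗[ℚ] F`, p7's `eigenline F σ'` (`σ' = σ.toRatAlgHom`) and p1's `eigenspaceF F σ` are
the same set of vectors. -/
theorem eigenline_eq_eigenspaceF (σ : F →+* ℂ) :
    ((A1EigenlineDecomposition.eigenline F σ.toRatAlgHom : Submodule _ (ℂ ⊗[ℚ] F)) : Set (ℂ ⊗[ℚ] F)) =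
      (eigenspaceF F σ : Set (ℂ ⊗[ℚ] F)) := by
  ext x
  change (∀ a : F, ((1 : ℂ) ⊗ₜ[ℚ] a) • x = (σ.toRatAlgHom a ⊗ₜ[ℚ] (1 : F)) • x) ↔ _
  rw [SetLike.mem_coe, T5ConjugateEigenlines.mem_jointEigenspace_iff]
  simp only [smul_eq_mul, one_tmul_mul, tmul_one_mul, RingHom.toRatAlgHom_apply]

end Bridge

end Summit.Ventures.HodgeRepro2.T5EigenlineBridge
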